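import Summits.BirchSwinnertonDyer.BirchSwinnertonDyer.Theorems.ErratumRoadFiveNonSurjCornerHybridDischarged
import Literature.NumberTheory.EllipticCurves.OrdinaryPrimesProofs
import HarnessLib

/-!
# Route `ErratumRoadFive` (rung K2), crux `NonSurjCorner` (item stmt-BirchSwinnertonDyer-19065), registered line `Lines/hybrid.lean`: THE STRUCTURAL
# RESIDUAL `stub_threeSplit57` THINNED BY A CONGRUENCE CONDITION — the admissibility datum is automatic unless the curve has THREE split
# multiplicative primes `q ≠ p` each `≡ 1 (mod p)` or equal to `2`; glue #6 with exactly that residual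
# (cell `bsd-stepL`, seat `bsd-stepL-corner-p1` g14; `--supports stmt-BirchSwinnertonDyer-19065 --as helper`)

WHY THIS FILE. The registered residual `stub_threeSplit57` (r1′) is «corner pair with three distinct split multiplicative primes `q₁,q₂,q₃ ≠ p` ⟹
`Typed.MissingUpperBoundAt W p`»; g13 proved the datum of the Shimura roads automatic with AT MOST TWO split primes `≠ p`
(`NonSurjCorner.admissibleUpToOneDatum_of_atMostTwoSplit`, p587691). THIS FILE proves the datum automatic in EVERY configuration of split primes as
long as at most two of the split primes `q ≠ p` are «bad» for the Papikian–Rabinoff half (`q = 2` or `p ∣ q − 1`): with `O` = the split multiplicative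
primes `≠ p` (a finite set: they divide `Δ_min`), `G ⊆ O` the good ones (odd, `p ∤ q − 1`) and `#(O ∖ G) ≤ 2`,
* `#O` odd: `S = {p} ∪ O` (even), `R = {p} ∪ R₀` with `R₀ ⊆ G`, `#R₀ = (#O − 1)/2 ≤ #O − 2 ≤ #G` (first form of the datum; every split `ℓ ∉ S` would be `p`
  or lie in `O` — vacuous);
* `#O` even (`≥ 2`): exempt ONE split prime `q₀ ∈ O` (a bad one if any), `S = {p} ∪ (O ∖ {q₀})` (even, `p ∈ S`, `q₀ ∉ S`), `R = {p} ∪ R₀`, `R₀ ⊆ G ∖ {q₀}`,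
  `#R₀ = #O/2 − 1` (up-to-one form).
No Tamagawa-carrier language is needed: on the corner every split multiplicative prime is a carrier anyway (lane B `NonSurjCorner.dvd_tamagawaNumberAt_iff_split`),
and the datum's offender clause is vacuous once all split primes `≠ p` but the exempted one lie in `S ∋ p`.
Hence the line's ONE structural residual thins to the clean crux shape
  «(T4′) corner pair ∧ three distinct split multiplicative primes `q₁,q₂,q₃ ≠ p`, EACH with `q_i = 2 ∨ p ∣ q_i − 1` ⟹ `Typed.MissingUpperBoundAt W p`»
(population: none known — no known corner pair at 5 or 7 has even three split primes `≠ p`, memo CORNER-G13 §2; the new shape asks in addition that all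
three lie in the class `1 mod p` or be `2`).
* `NonSurjCorner.admissibleUpToOneDatum_of_atMostTwoBadSplit` — corner ∧ multi-carrier ∧ «no three distinct bad split primes ≠ p» ⟹ the datum (`hadm''`).
* glue #6 `nonSurjCorner_of_kolyZ_of_twinMuAn_of_katoFacts_of_lowerX11a_of_sixNamedInputs_of_savedDisplay_of_threeBadSplit` — glue #4 (p592188) with
  `hres3` replaced by the thinner `hres3bad`. Candidate composition of `Lines/hybrid.lean` r3 (= r2 with `stub_threeSplit57` thinned).

HONEST FRAMING: THEOREMS ONLY (no definition, no named fact, no `sorry`); CONDITIONAL on every displayed binder (OPEN: 19946, 19948, 19064, lane B's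
`Theorems.ShimuraInertSavedDisplayAt`, the residual `hres3bad`; UNPROVED named facts: 3 + 6); item 19065 is NOT closed; nothing about any curve's BSD;
BSD is not advanced; T7.
References (locators only): [cite: PapikianRabinoff2016, Cor. 3.5] [cite: PastenShimura2024, Lemma 6.18] [cite: JetchevSkinnerWan2017, §7.4.2]
[cite: SilvermanATAEC1994, Cor. IV.9.2(d)].
-/

set_option autoImplicit false
set_option linter.dupNamespace false -- `Summit.BirchSwinnertonDyer.BirchSwinnertonDyer` (summit = problem), tree-wide

noncomputable section

open scoped Classical NumberField MatrixGroups ModularForm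

namespace Summit.BirchSwinnertonDyer.BirchSwinnertonDyer.Theorems

open CongruenceSubgroup WeierstrassCurve NumberField IsDedekindDomain Field Rat.HeightOneSpectrum
  Literature.NumberTheory.EllipticCurves
  Literature.NumberTheory.EllipticCurves.ModularForms
  Literature.NumberTheory.EllipticCurves.Rank1Residual
  Literature.NumberTheory.EllipticCurves.Rank1Residual.Typed
  Literature.NumberTheory.EllipticCurves.Wuthrich2014
  Literature.NumberTheory.EllipticCurves.SteinWuthrich2013
  Literature.NumberTheory.EllipticCurves.Greenberg1999
  Literature.NumberTheory.EllipticCurves.Kato2004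
  Literature.NumberTheory.EllipticCurves.BarriosEtAl2025
  Literature.NumberTheory.GaloisRepresentations Literature.NumberTheory.GaloisCohomology
  Literature.NumberTheory.Automorphic
  Summit.BirchSwinnertonDyer.Rank1Residual
  Summit.BirchSwinnertonDyer.Rank1Residual.X11b

/-- **The hybrid line's datum is AUTOMATIC unless three split multiplicative primes `≠ p` are all `≡ 1 (mod p)` or `= 2`.** On a (T4′) corner pair
(`ClassX11b W p`, `¬ Surj W p`, `p ∈ {5,7}`) that is MULTI-carrier and has NO three distinct split multiplicative primes `q₁,q₂,q₃ ≠ p` with each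
`q_i = 2 ∨ p ∣ q_i − 1`: EITHER an even set `S` of multiplicative primes carrying every split offender with a Papikian–Rabinoff half `R` (`#S = 2#R`, every
`q ∈ R` odd with `p ∤ q − 1`), OR a split multiplicative `q₀` and such an `S ∋ p`, `q₀ ∉ S`, carrying every other split offender. Construction: `O` = split
multiplicative primes `≠ p`; `#O` odd ⟹ `S = {p} ∪ O`, `R = {p} ∪ R₀`, `R₀` = `(#O−1)/2` good elements of `O`; `#O` even ⟹ exempt `q₀ ∈ O` (bad if
possible), `S = {p} ∪ (O ∖ {q₀})`, `R = {p} ∪ R₀`, `R₀` = `#O/2 − 1` good elements of `O ∖ {q₀}`. [cite: PapikianRabinoff2016, Cor. 3.5 (shape of the half)]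
[cite: SilvermanATAEC1994, Cor. IV.9.2(d)] -/
theorem NonSurjCorner.admissibleUpToOneDatum_of_atMostTwoBadSplit
    (W : WeierstrassCurve ℚ) [W.IsElliptic] [W.IsGloballyMinimal] (p : ℕ) [Fact p.Prime]
    (hX : ClassX11b W p) (hns : ¬ Surj W p) (h57 : p = 5 ∨ p = 7)
    (htam : p ∣ W.tamagawaProduct)
    (hmulti : ∀ v : HeightOneSpectrum (𝓞 ℚ), padicValNat p (W.tamagawaNumberAt v) < padicValNat p W.tamagawaProduct)
    (h3 : ∀ (q₁ q₂ q₃ : ℕ) [Fact q₁.Prime] [Fact q₂.Prime] [Fact q₃.Prime], q₁ ≠ p → q₂ ≠ p → q₃ ≠ p →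
      q₁ ≠ q₂ → q₁ ≠ q₃ → q₂ ≠ q₃ →
      W.HasSplitMultiplicativeReductionAtPrime q₁ → W.HasSplitMultiplicativeReductionAtPrime q₂ →
      W.HasSplitMultiplicativeReductionAtPrime q₃ →
      (q₁ = 2 ∨ p ∣ q₁ - 1) → (q₂ = 2 ∨ p ∣ q₂ - 1) → (q₃ = 2 ∨ p ∣ q₃ - 1) → False) :
    (∃ S : Finset ℕ, (∀ ℓ ∈ S, ∃ _ : Fact ℓ.Prime, Mult W ℓ) ∧ Even S.card ∧
        (∀ (ℓ : ℕ) [Fact ℓ.Prime], ℓ ∉ S → W.HasSplitMultiplicativeReductionAtPrime ℓ →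
          ¬ p ∣ padicValInt ℓ W.minimalDiscriminantInt) ∧
        ∃ R ⊆ S, S.card = 2 * R.card ∧ ∀ q ∈ R, q ≠ 2 ∧ ¬ p ∣ q - 1) ∨
      (∃ (q₁ : ℕ) (_ : Fact q₁.Prime), W.HasSplitMultiplicativeReductionAtPrime q₁ ∧
        ∃ S : Finset ℕ, (∀ ℓ ∈ S, ∃ _ : Fact ℓ.Prime, Mult W ℓ) ∧ Even S.card ∧ p ∈ S ∧ q₁ ∉ S ∧
          (∀ (ℓ : ℕ) [Fact ℓ.Prime], ℓ ∉ S → ℓ ≠ q₁ → W.HasSplitMultiplicativeReductionAtPrime ℓ →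
            ¬ p ∣ padicValInt ℓ W.minimalDiscriminantInt) ∧
          ∃ R ⊆ S, S.card = 2 * R.card ∧ ∀ q ∈ R, q ≠ 2 ∧ ¬ p ∣ q - 1) := by
  have hp : p.Prime := Fact.out
  have h5 : 5 ≤ p := by rcases h57 with rfl | rfl <;> norm_num
  have hp2 : p ≠ 2 := by omega
  have hpp : ¬ p ∣ p - 1 := fun h ↦ by
    have := Nat.le_of_dvd (by omega) h
    omega
  have hmultp : Mult W p := hX.2.2.1
  -- the finite set `O` of split multiplicative primes `≠ p` (they divide `Δ_min`)
  set O : Finset ℕ := (W.minimalDiscriminantInt.natAbs.primeFactors.erase p).filter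
    (fun q ↦ ∃ hq : q.Prime, @WeierstrassCurve.HasSplitMultiplicativeReductionAtPrime W q ⟨hq⟩) with hO
  have hOspec : ∀ ℓ ∈ O, ∃ hℓ : Fact ℓ.Prime, ℓ ≠ p ∧ W.HasSplitMultiplicativeReductionAtPrime ℓ := by
    intro ℓ hℓ
    rw [hO, Finset.mem_filter, Finset.mem_erase] at hℓ
    obtain ⟨⟨hℓp, -⟩, hq, hs⟩ := hℓ
    exact ⟨⟨hq⟩, hℓp, hs⟩
  have hmemO : ∀ (ℓ : ℕ) [Fact ℓ.Prime], ℓ ≠ p → W.HasSplitMultiplicativeReductionAtPrime ℓ → ℓ ∈ O := by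
    intro ℓ _ hℓp hs
    have hℓ : ℓ.Prime := Fact.out
    have hdvd : (ℓ : ℤ) ∣ W.minimalDiscriminantInt := by
      by_contra hnd
      exact WeierstrassCurve.HasMultiplicativeReduction.not_hasGoodReduction (R := ℤ_[ℓ]) hs.hasMultiplicativeReductionAtPrime
        (hasGoodReductionAtPrime_of_not_dvd W ℓ hnd)
    rw [hO, Finset.mem_filter, Finset.mem_erase, Nat.mem_primeFactors]
    exact ⟨⟨hℓp, hℓ, Int.ofNat_dvd_left.mp hdvd, Int.natAbs_ne_zero.mpr (minimalDiscriminantInt_ne_zero W)⟩, hℓ, hs⟩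
  have hpO : p ∉ O := fun h ↦ (hOspec p h).2.1 rfl
  -- good / bad split primes
  set B : Finset ℕ := O.filter (fun q ↦ q = 2 ∨ p ∣ q - 1) with hB
  set G : Finset ℕ := O.filter (fun q ↦ ¬ (q = 2 ∨ p ∣ q - 1)) with hG
  have hBG : B.card + G.card = O.card := Finset.card_filter_add_card_filter_not _
  have hGO : G ⊆ O := Finset.filter_subset _ _
  have hGgood : ∀ q ∈ G, q ≠ 2 ∧ ¬ p ∣ q - 1 := by
    intro q hq
    rw [hG, Finset.mem_filter] at hq
    push Not at hq
    exact hq.2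
  have hBle : B.card ≤ 2 := by
    by_contra hlt
    have hlt' : 2 < B.card := by omega
    obtain ⟨a, b, c, ha, hb, hc, hab, hac, hbc⟩ := Finset.two_lt_card_iff.mp hlt'
    rw [hB, Finset.mem_filter] at ha hb hc
    obtain ⟨ia, hap, hsa⟩ := hOspec a ha.1
    obtain ⟨ib, hbp, hsb⟩ := hOspec b hb.1
    obtain ⟨ic, hcp, hsc⟩ := hOspec c hc.1
    exact h3 a b c hap hbp hcp hab hac hbc hsa hsb hsc ha.2 hb.2 hc.2
  -- a split multiplicative prime `q ≠ p` exists (multi-carrier), so `O` is non-empty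
  obtain ⟨v₁, v₂, hne, hs₁, hs₂⟩ :=
    (CornerLocal.NonSurjCorner.multiCarrier_iff_two_split W p hX hns h5).mp ⟨htam, hmulti⟩
  haveI i₁ : Fact (primesEquiv v₁ : ℕ).Prime := ⟨(primesEquiv v₁).2⟩
  haveI i₂ : Fact (primesEquiv v₂ : ℕ).Prime := ⟨(primesEquiv v₂).2⟩
  have hsq₁ : W.HasSplitMultiplicativeReductionAtPrime (primesEquiv v₁ : ℕ) :=
    (W.hasSplitMultiplicativeReductionAtPrime_iff_hasSplitMultiplicativeReductionAt v₁).mpr hs₁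
  have hsq₂ : W.HasSplitMultiplicativeReductionAtPrime (primesEquiv v₂ : ℕ) :=
    (W.hasSplitMultiplicativeReductionAtPrime_iff_hasSplitMultiplicativeReductionAt v₂).mpr hs₂
  have hq12 : (primesEquiv v₁ : ℕ) ≠ (primesEquiv v₂ : ℕ) := fun h ↦
    hne (primesEquiv.injective (Subtype.ext h))
  obtain ⟨q, hqF, hqp, hsq⟩ : ∃ (q : ℕ) (_ : Fact q.Prime), q ≠ p ∧ W.HasSplitMultiplicativeReductionAtPrime q := by
    by_cases h : (primesEquiv v₁ : ℕ) = p
    · exact ⟨(primesEquiv v₂ : ℕ), i₂, fun h' ↦ hq12 (h.trans h'.symm), hsq₂⟩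
    · exact ⟨(primesEquiv v₁ : ℕ), i₁, h, hsq₁⟩
  haveI := hqF
  have hqO : q ∈ O := hmemO q hqp hsq
  have hOpos : 0 < O.card := Finset.card_pos.mpr ⟨q, hqO⟩
  -- members of `{p} ∪ T`, `T ⊆ O`, are multiplicative primes
  have hSmult : ∀ T ⊆ O, ∀ ℓ ∈ insert p T, ∃ _ : Fact ℓ.Prime, Mult W ℓ := by
    intro T hT ℓ hℓ
    rcases Finset.mem_insert.mp hℓ with rfl | hℓT
    · exact ⟨inferInstance, hmultp⟩
    · obtain ⟨iℓ, -, hs⟩ := hOspec ℓ (hT hℓT)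
      exact ⟨iℓ, hs.hasMultiplicativeReductionAtPrime⟩
  rcases Nat.even_or_odd O.card with heven | hodd
  · -- `#O` even: exempt one split prime `q₀` (a bad one if there is any)
    obtain ⟨q₀, hq₀O, hq₀B⟩ : ∃ q₀ ∈ O, (B.Nonempty → q₀ ∈ B) := by
      by_cases hBne : B.Nonempty
      · obtain ⟨b, hb⟩ := hBne
        exact ⟨b, (Finset.mem_filter.mp hb).1, fun _ ↦ hb⟩
      · exact ⟨q, hqO, fun h ↦ (hBne h).elim⟩
    obtain ⟨i₀, hq₀p, hsq₀⟩ := hOspec q₀ hq₀O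
    -- enough good primes remain after exempting `q₀`
    have hGcard : O.card / 2 - 1 ≤ (G.erase q₀).card := by
      by_cases hBne : B.Nonempty
      · have hq₀G : q₀ ∉ G := by
          have hb := hq₀B hBne
          rw [hB, Finset.mem_filter] at hb
          rw [hG, Finset.mem_filter]
          exact fun h ↦ h.2 hb.2
        rw [Finset.erase_eq_of_notMem hq₀G]
        omega
      · have hB0 : B.card = 0 := by
          rw [Finset.card_eq_zero]
          exact Finset.not_nonempty_iff_eq_empty.mp hBne
        have hq₀G : q₀ ∈ G := by
          rw [hG, Finset.mem_filter]
          refine ⟨hq₀O, fun hbad ↦ hBne ⟨q₀, ?_⟩⟩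
          rw [hB, Finset.mem_filter]
          exact ⟨hq₀O, hbad⟩
        rw [Finset.card_erase_of_mem hq₀G]
        omega
    obtain ⟨R₀, hR₀G, hR₀card⟩ := Finset.le_card_iff_exists_subset_card.mp hGcard
    have hR₀O : R₀ ⊆ O.erase q₀ := fun x hx ↦ by
      have hxG := hR₀G hx
      exact Finset.mem_erase_of_ne_of_mem (Finset.ne_of_mem_erase hxG) (hGO (Finset.mem_of_mem_erase hxG))
    have hpR₀ : p ∉ R₀ := fun h ↦ hpO (Finset.mem_of_mem_erase (hR₀O h))
    have hpOe : p ∉ O.erase q₀ := fun h ↦ hpO (Finset.mem_of_mem_erase h)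
    refine Or.inr ⟨q₀, i₀, hsq₀, insert p (O.erase q₀), hSmult _ (Finset.erase_subset _ _), ?_, Finset.mem_insert_self _ _,
      ?_, ?_, insert p R₀, Finset.insert_subset_insert _ hR₀O, ?_, ?_⟩
    · rw [Finset.card_insert_of_notMem hpOe, Finset.card_erase_of_mem hq₀O]
      obtain ⟨k, hk⟩ := heven
      exact ⟨k, by omega⟩
    · intro h
      rcases Finset.mem_insert.mp h with h₁ | h₂
      · exact hq₀p h₁
      · exact Finset.notMem_erase q₀ O h₂
    · intro ℓ _ hℓS hℓq₀ hs hdv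
      by_cases hℓp : ℓ = p
      · exact hℓS (by rw [hℓp]; exact Finset.mem_insert_self _ _)
      · exact hℓS (Finset.mem_insert_of_mem (Finset.mem_erase_of_ne_of_mem hℓq₀ (hmemO ℓ hℓp hs)))
    · rw [Finset.card_insert_of_notMem hpOe, Finset.card_erase_of_mem hq₀O, Finset.card_insert_of_notMem hpR₀, hR₀card]
      obtain ⟨k, hk⟩ := heven
      omega
    · intro x hx
      rcases Finset.mem_insert.mp hx with rfl | hxR
      · exact ⟨hp2, hpp⟩
      · exact hGgood x (Finset.mem_of_mem_erase (hR₀G hxR))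
  · -- `#O` odd: `S = {p} ∪ O`
    have hGcard : (O.card - 1) / 2 ≤ G.card := by
      obtain ⟨k, hk⟩ := hodd
      omega
    obtain ⟨R₀, hR₀G, hR₀card⟩ := Finset.le_card_iff_exists_subset_card.mp hGcard
    have hR₀O : R₀ ⊆ O := hR₀G.trans hGO
    have hpR₀ : p ∉ R₀ := fun h ↦ hpO (hR₀O h)
    refine Or.inl ⟨insert p O, hSmult O le_rfl, ?_, ?_, insert p R₀, Finset.insert_subset_insert _ hR₀O, ?_, ?_⟩
    · rw [Finset.card_insert_of_notMem hpO]
      obtain ⟨k, hk⟩ := hodd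
      exact ⟨k + 1, by omega⟩
    · intro ℓ _ hℓS hs hdv
      by_cases hℓp : ℓ = p
      · exact hℓS (by rw [hℓp]; exact Finset.mem_insert_self _ _)
      · exact hℓS (Finset.mem_insert_of_mem (hmemO ℓ hℓp hs))
    · rw [Finset.card_insert_of_notMem hpO, Finset.card_insert_of_notMem hpR₀, hR₀card]
      obtain ⟨k, hk⟩ := hodd
      omega
    · intro x hx
      rcases Finset.mem_insert.mp hx with rfl | hxR
      · exact ⟨hp2, hpp⟩
      · exact hGgood x (hR₀G hxR)

/-- **THE HYBRID GLUE (glue #6) WITH THE THINNED RESIDUAL «three split multiplicative primes `≠ p`, all `≡ 1 (mod p)` or `= 2`».** As glue #4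
(`…_of_sixNamedInputs_of_savedDisplay_of_threeSplit`, p592188): `NonSurjCornerKolyZ` (19946) → `NonSurjCornerTwinMuAn` (19948) → `KatoTwinFactsFiveAn` (19949)
→ `X11aLowerHalf` (19950 ∕ 19064) → hMax (3 names) → hShim6 (6 names) → the SAVED display (lane B's OPEN typed object) → **`hres3bad`** (the corner's upper half
at the pairs with three distinct split multiplicative primes `q₁,q₂,q₃ ≠ p`, EACH `= 2` or `≡ 1 (mod p)`) → `NonSurjCorner`. Proof: the hybrid glue
p579499 with `hUmulti` := if three distinct bad split primes `≠ p` exist, `hres3bad`; otherwise the datum of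
`NonSurjCorner.admissibleUpToOneDatum_of_atMostTwoBadSplit`, then the admissible road (g12 ∕ g13) or the up-to-one road (p585499), exactly as in glue #3;
the two discharged Shimura-road inputs are the tree theorems of glue #4. CONDITIONAL on every binder; 19065 NOT closed; nothing booked; T7.
[cite: Cha2005, Thm. 21 and Rmk. 25] [cite: JetchevSkinnerWan2017, §7.4.2] [cite: PapikianRabinoff2016, Cor. 3.5] -/
theorem nonSurjCorner_of_kolyZ_of_twinMuAn_of_katoFacts_of_lowerX11a_of_sixNamedInputs_of_savedDisplay_of_threeBadSplit
    (hZ : NonSurjCornerKolyZ) (hμ : NonSurjCornerTwinMuAn)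
    (hF : Summit.BirchSwinnertonDyer.BirchSwinnertonDyer.Theses.ErratumRoadFive.KatoTwinFactsFiveAn)
    (h₄ : Summit.BirchSwinnertonDyer.BirchSwinnertonDyer.Theses.ErratumRoadFive.X11aLowerHalf)
    (hMax : GrossLMS1991.prop37_2_frobeniusCongruence ∧
      (∀ (K : Type) [Field K] [NumberField K], poitouTate_selmerStructure_duality_conj K) ∧
      Gross1991_heegnerPoint_sub_ratTorsion_mem_E0_imageFree)
    (hShim6 : friedbergHoffstein_exists_twist_ne_zero_inertAt ∧ nonempty_shimuraParametrizationData ∧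
      PastenShimura2024_componentOrders ∧
      (∀ (K : Type) [Field K] [NumberField K], casselsTate_levelInputs K) ∧
      shimuraCurve_heegnerSystem_primitivesFromFiveIrr ∧ shimuraCurve_heegnerSystem_primitivesSplitReduced)
    (hSav : ∀ (W : WeierstrassCurve ℚ) [W.IsElliptic] [W.IsGloballyMinimal] (p : ℕ) [Fact p.Prime],
      ClassX11b W p → ¬ Surj W p → (p = 5 ∨ p = 7) → ∀ (q₁ : ℕ) [Fact q₁.Prime], ShimuraInertSavedDisplayAt W p q₁)
    -- the ONE structural residual, thinned: three further split multiplicative primes, all `≡ 1 (mod p)` or `= 2`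
    (hres3bad : ∀ (W : WeierstrassCurve ℚ) [W.IsElliptic] [W.IsGloballyMinimal] (p : ℕ) [Fact p.Prime],
      ClassX11b W p → ¬ Surj W p → (p = 5 ∨ p = 7) → p ∣ padicValInt p W.minimalDiscriminantInt → ¬ Ram W p →
      ∀ (q₁ q₂ q₃ : ℕ) [Fact q₁.Prime] [Fact q₂.Prime] [Fact q₃.Prime], q₁ ≠ p → q₂ ≠ p → q₃ ≠ p →
      q₁ ≠ q₂ → q₁ ≠ q₃ → q₂ ≠ q₃ →
      W.HasSplitMultiplicativeReductionAtPrime q₁ → W.HasSplitMultiplicativeReductionAtPrime q₂ →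
      W.HasSplitMultiplicativeReductionAtPrime q₃ →
      (q₁ = 2 ∨ p ∣ q₁ - 1) → (q₂ = 2 ∨ p ∣ q₂ - 1) → (q₃ = 2 ∨ p ∣ q₃ - 1) → Typed.MissingUpperBoundAt W p) :
    Summit.BirchSwinnertonDyer.BirchSwinnertonDyer.Theses.ErratumRoadFive.NonSurjCorner := by
  obtain ⟨hGZ, hKo, hWu, hGZK, hmod, hnf, hpar, hFHs, hMaz, hrec, hD36, hJs, hJn, hGS, hChaL, hChaU, hne, h12,
    hns, hsp, h15, h18, hfine⟩ := hF
  obtain ⟨h37, hPTs, hF1⟩ := hMax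
  obtain ⟨hFH, hJL, hCO, hCT, hLab, hLabS⟩ := hShim6
  have hPT : ∀ (K : Type) [Field K] [NumberField K],
      Literature.NumberTheory.GaloisCohomology.poitouTate_sum_localTatePairing_eq_zero K :=
    poitouTate_sum_localTatePairing_eq_zero_holds
  have hBR : localTamagawaNumber_quadraticTwist_two_mem_of_goodReduction :=
    BarriosEtAl2025.localTamagawaNumber_quadraticTwist_two_mem_of_goodReduction_holds
  exact X11b.erratumRoadFive_nonSurjCorner_of_kolyZ_of_kolyJMax_of_multiUpper_of_lowerX11a_of_twinMultDivisibility hGZ hKo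
    hWu hGZK hmod hnf hpar hFHs hMaz hrec hD36 hJs hJn hGS hChaL hChaU h₄
    (fun W _ _ p _ N _ K _ _ Dt β ι ↦ hZ W p N K Dt β ι)
    (X11b.Three.Koly.nonSurjCornerKolyJ_max_of_threeNamedFacts h37 hPTs hF1)
    (fun W _ _ p _ hX hns' h57 hv hnr htam hmulti ↦ by
      by_cases h3 : ∃ (q₁ q₂ q₃ : ℕ) (_ : Fact q₁.Prime) (_ : Fact q₂.Prime) (_ : Fact q₃.Prime), q₁ ≠ p ∧ q₂ ≠ p ∧ q₃ ≠ p ∧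
          q₁ ≠ q₂ ∧ q₁ ≠ q₃ ∧ q₂ ≠ q₃ ∧ W.HasSplitMultiplicativeReductionAtPrime q₁ ∧
          W.HasSplitMultiplicativeReductionAtPrime q₂ ∧ W.HasSplitMultiplicativeReductionAtPrime q₃ ∧
          (q₁ = 2 ∨ p ∣ q₁ - 1) ∧ (q₂ = 2 ∨ p ∣ q₂ - 1) ∧ (q₃ = 2 ∨ p ∣ q₃ - 1)
      · obtain ⟨q₁, q₂, q₃, i₁, i₂, i₃, h1p, h2p, h3p, h12', h13, h23, hs1, hs2, hs3, hb1, hb2, hb3⟩ := h3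
        haveI := i₁; haveI := i₂; haveI := i₃
        exact hres3bad W p hX hns' h57 hv hnr q₁ q₂ q₃ h1p h2p h3p h12' h13 h23 hs1 hs2 hs3 hb1 hb2 hb3
      · have hno : ∀ (q₁ q₂ q₃ : ℕ) [Fact q₁.Prime] [Fact q₂.Prime] [Fact q₃.Prime], q₁ ≠ p → q₂ ≠ p → q₃ ≠ p →
            q₁ ≠ q₂ → q₁ ≠ q₃ → q₂ ≠ q₃ →
            W.HasSplitMultiplicativeReductionAtPrime q₁ → W.HasSplitMultiplicativeReductionAtPrime q₂ →
            W.HasSplitMultiplicativeReductionAtPrime q₃ →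
            (q₁ = 2 ∨ p ∣ q₁ - 1) → (q₂ = 2 ∨ p ∣ q₂ - 1) → (q₃ = 2 ∨ p ∣ q₃ - 1) → False :=
          fun q₁ q₂ q₃ _ _ _ h1p h2p h3p h12' h13 h23 hs1 hs2 hs3 hb1 hb2 hb3 ↦
            h3 ⟨q₁, q₂, q₃, inferInstance, inferInstance, inferInstance, h1p, h2p, h3p, h12', h13, h23, hs1, hs2, hs3,
              hb1, hb2, hb3⟩
        rcases NonSurjCorner.admissibleUpToOneDatum_of_atMostTwoBadSplit W p hX hns' h57 htam hmulti hno with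
          hadm | ⟨q₁, hq₁F, hq₁, hdat⟩
        · exact NonSurjCorner.missingUpperBoundAt_of_admissibleSet_of_primitives hGZK hmod hnf hFH hMaz hJL hCO hPT hCT hLab
            hLabS W p hX hns' h57 hnr (fun Wd _ _ hXa ↦ h₄ Wd p hXa) hadm
        · haveI := hq₁F
          exact NonSurjCorner.missingUpperBoundAt_of_admissibleUpToOne_of_savedDisplay hGZK hmod hnf hFH hMaz hBR hJL hCO W p
            hX hns' h57 hnr (fun Wd _ _ hXa ↦ h₄ Wd p hXa) q₁ hq₁ (hSav W p hX hns' h57 q₁) hdat)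
    (fun Wd _ _ p _ hXa hnsd h57 hvd ↦
      X11b.multDivisibilityAt_of_katoFacts_of_muAn hne h12 hns hsp h15 h18 hfine Wd p hXa.2.1 hXa.2.2.1
        hXa.2.2.2.1 hnsd (fun f hf ϖ hϖ a L hsa hna hL ↦ hμ Wd p hXa hnsd h57 hvd f hf ϖ hϖ a L hsa hna hL))

end Summit.BirchSwinnertonDyer.BirchSwinnertonDyer.Theorems

end
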